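import Literature.NumberTheory.LFunctions.RayClassLSeriesFEModulus
import HarnessLib

/-!
# The uniform convexity bound for Hecke `L`-series of primitive ray class characters

Topic `Literature/NumberTheory/LFunctions`; namespace `Literature.NumberTheory.LFunctions`.  Pure-proof
companion of `RayClassLSeriesFEModulus.lean`, `RayClassLSeriesGrowth.lean` and
`Literature/Analysis/Complex/RademacherPhragmenLindelof.lean`.  Everything here is PROVED; no definition
and no named fact is introduced.

**Theorem** (`exists_continuation_norm_le`; Rademacher 1959, Theorem 5, for Hecke `L`-functions with
Größencharacters — here ray class characters — in a simplified form with absolute numerical constants,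
uniform in the field and the modulus).  Let `χ` be a primitive ray class character `mod 𝔪 ≠ 0` of the
number field `K` (`n = [K:ℚ]`), of sign type `p`, non-principal on the ideals prime to `𝔪`.  Then the
entire continuation `L` of `L(χ, ·)` satisfies, for `Re z ≥ −1/2`,

  `|L(z)| ≤ |d_K| 𝔑(𝔪) · e^{2n} · |z + 5/2|^{n}`.

Proof: Rademacher's Phragmén–Lindelöf theorem on the strip `−1/2 ≤ σ ≤ 3/2` with `Q = 5/2`: on
`σ = 3/2`, `|L| ≤ e^{2n}` (`norm_rayClassLSeries_le_exp`); on `σ = −1/2`, by the functional equation in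
modulus (`norm_continuation_le_of_re_eq_neg_half`), `|L| ≤ |d_K|𝔑𝔪 e^{2n} |Q+z|^{n}`; the a-priori finite
order is `exists_differentiable_eq_rayClassLSeries_finiteOrder`; for `σ ≥ 3/2` the Dirichlet series bound
applies directly.  This is the ray-class analogue of the tree's `norm_dedekindZeta₁_le`
(`DedekindZetaEntireConvexity.lean`) and the first input (uniform size of `L(s, χ)` in the critical strip,
in terms of the conductor–discriminant `|d_K| 𝔑(𝔣_χ)`) of the zero-counting and explicit-formula
estimates for Hecke `L`-functions in the Linnik range.

## References

* H. Rademacher, *On the Phragmén–Lindelöf theorem and some applications*, Math. Z. 72 (1959), 192–204,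
  Theorems 2 and 5. [Rademacher1959]
* J. Neukirch, *Algebraic Number Theory*, Grundlehren 322, Springer 1999, Ch. VII §8 (8.5)–(8.6). [NeukirchANT1999]
-/

noncomputable section

open Complex NumberField NumberField.InfinitePlace NumberField.Units IsDedekindDomain Filter Topology Set Metric
open scoped NumberField nonZeroDivisors
open scoped Classical

namespace Literature.NumberTheory.LFunctions

variable {K : Type*} [Field K] [NumberField K]
variable {𝔪 : Ideal (𝓞 K)} {ψ : HeightOneSpectrum (𝓞 K) → ℂ} {p : Finset {w : InfinitePlace K // IsReal w}}

set_option maxHeartbeats 1600000 in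
/-- **Uniform convexity bound for the Hecke `L`-series of a primitive ray class character** (Rademacher
1959, Thm. 5, simplified): for `χ` primitive `mod 𝔪 ≠ 0` of sign type `p`, non-principal on the ideals prime
to `𝔪`, the entire continuation `L` of `L(χ, ·)` satisfies `|L(z)| ≤ |d_K| 𝔑(𝔪) e^{2 n_K} |z + 5/2|^{n_K}`
for `Re z ≥ −1/2`. [cite: Rademacher1959, Theorem 5] -/
theorem exists_continuation_norm_le (hψ : IsRayClassCharacter 𝔪 ψ) (hprim : IsPrimitive 𝔪 ψ)
    (hp : IsSignType 𝔪 ψ p) (h𝔪 : 𝔪 ≠ ⊥)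
    (hnt : ∃ v : HeightOneSpectrum (𝓞 K), ¬ 𝔪 ≤ v.asIdeal ∧ ψ v ≠ 1) :
    ∃ L : ℂ → ℂ, Differentiable ℂ L ∧ (∀ s : ℂ, 1 < s.re → L s = rayClassLSeries 𝔪 ψ s) ∧
      ∀ z : ℂ, -1 / 2 ≤ z.re →
        ‖L z‖ ≤ (|(discr K : ℝ)| * (Ideal.absNorm 𝔪 : ℝ)) * Real.exp (2 * Module.finrank ℚ K) *
          ‖z + 5 / 2‖ ^ Module.finrank ℚ K := by
  obtain ⟨L, hLd, hLg, hLs⟩ := exists_differentiable_eq_rayClassLSeries_finiteOrder h𝔪 hψ hnt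
  refine ⟨L, hLd, hLs, fun z hz₁ ↦ ?_⟩
  set n : ℕ := Module.finrank ℚ K with hn
  set d : ℝ := |(discr K : ℝ)| * (Ideal.absNorm 𝔪 : ℝ) with hd
  set E : ℝ := Real.exp (2 * n) with hE
  have hd1 : 1 ≤ d := by
    have h1 : (1 : ℝ) ≤ |(discr K : ℝ)| := by
      have := Int.one_le_abs (discr_ne_zero K)
      rw [← Int.cast_abs]; exact_mod_cast this
    have h2 : (1 : ℝ) ≤ (Ideal.absNorm 𝔪 : ℝ) := by
      exact_mod_cast Nat.one_le_iff_ne_zero.mpr (by rwa [ne_eq, Ideal.absNorm_eq_zero_iff])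
    rw [hd]; nlinarith
  have hd0 : 0 < d := by linarith
  have hE0 : 0 < E := Real.exp_pos _
  have hE1 : 1 ≤ E := Real.one_le_exp (by positivity)
  have hψ1 : ∀ v : HeightOneSpectrum (𝓞 K), ¬ 𝔪 ≤ v.asIdeal → ‖ψ v‖ ≤ 1 := fun v hv ↦ (hψ.norm_eq_one v hv).le
  -- the norm `N = |Q + z|`, `Q = 5/2`
  have hQz : ((5 / 2 : ℝ) : ℂ) + z = z + 5 / 2 := by push_cast; ring
  have hN2 : ∀ w : ℂ, -1 / 2 ≤ w.re → 2 ≤ ‖w + 5 / 2‖ := fun w hw ↦ by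
    have h3 : 2 ≤ (w + 5 / 2).re := by
      rw [Complex.add_re, show (5 / 2 : ℂ) = ((5 / 2 : ℝ) : ℂ) by push_cast; ring, Complex.ofReal_re]; linarith
    calc (2 : ℝ) ≤ |(w + 5 / 2).re| := h3.trans (le_abs_self _)
      _ ≤ ‖w + 5 / 2‖ := abs_re_le_norm _
  -- the right half-plane bound: `|L(w)| ≤ E` for `Re w ≥ 3/2`
  have hright : ∀ w : ℂ, 3 / 2 ≤ w.re → ‖L w‖ ≤ E := by
    intro w hw
    rw [hLs w (by linarith)]
    refine (norm_rayClassLSeries_le_exp h𝔪 hψ1 (by linarith)).trans (Real.exp_le_exp.mpr ?_)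
    have hn0 : (0 : ℝ) ≤ n := Nat.cast_nonneg _
    rw [div_le_iff₀ (by linarith)]
    nlinarith
  -- the case `Re z ≥ 3/2`
  rcases le_or_gt (3 / 2 : ℝ) z.re with hz3 | hz3
  · have hN1 : 1 ≤ ‖z + 5 / 2‖ := le_trans (by norm_num) (hN2 z hz₁)
    calc ‖L z‖ ≤ E := hright z hz3
      _ = 1 * E * 1 := by ring
      _ ≤ d * E * ‖z + 5 / 2‖ ^ n := by
          gcongr
          exact one_le_pow₀ hN1
  -- the strip `−1/2 ≤ Re z ≤ 3/2`: Rademacher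
  obtain ⟨C, hC, hgr₀⟩ := hLg (3 / 2) (by norm_num)
  have hgr : ∀ w : ℂ, (-1 / 2 : ℝ) < w.re → w.re < 3 / 2 → ‖L w‖ ≤ C * Real.exp (|w.im| ^ (3 : ℝ)) :=
    fun w hw1 hw2 ↦ hgr₀ w (abs_le.mpr ⟨by linarith, by linarith⟩)
  -- right edge
  have hb : ∀ w : ℂ, w.re = 3 / 2 → ‖L w‖ ≤ E * ‖((5 / 2 : ℝ) : ℂ) + w‖ ^ (0 : ℝ) := by
    intro w hw
    rw [Real.rpow_zero, mul_one]
    exact hright w hw.ge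
  -- left edge
  have ha : ∀ w : ℂ, w.re = -1 / 2 → ‖L w‖ ≤ d * E * ‖((5 / 2 : ℝ) : ℂ) + w‖ ^ ((n : ℕ) : ℝ) := by
    intro w hw
    rw [Real.rpow_natCast, show ((5 / 2 : ℝ) : ℂ) + w = w + 5 / 2 by push_cast; ring]
    exact norm_continuation_le_of_re_eq_neg_half hψ hprim hp h𝔪 hLd hLs hw
  -- Rademacher's theorem
  have hC' : 0 < max C 1 := lt_max_of_lt_right one_pos
  have hgr' : ∀ w : ℂ, (-1 / 2 : ℝ) < w.re → w.re < 3 / 2 → ‖L w‖ ≤ max C 1 * Real.exp (|w.im| ^ (3 : ℝ)) :=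
    fun w hw1 hw2 ↦ (hgr w hw1 hw2).trans (mul_le_mul_of_nonneg_right (le_max_left _ _) (Real.exp_pos _).le)
  have hR := Literature.Analysis.Complex.rademacher_phragmenLindelof_of_finiteOrder
    (f := L) (a := -1 / 2) (b := 3 / 2) (Q := 5 / 2) (A := d * E) (B := E)
    (α := ((n : ℕ) : ℝ)) (β := 0) (C := max C 1) (c := 3)
    (by norm_num) (by norm_num) (by positivity) hE0 (Nat.cast_nonneg _)
    hLd.diffContOnCl (by norm_num) hgr' ha hb hz₁ hz3.le
  rw [hQz, Real.rpow_zero, mul_one] at hR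
  -- simplify: `X^p' Y^q ≤ X` for `Y ≤ X`, `p' + q = 1`
  set N : ℝ := ‖z + 5 / 2‖ with hN
  have hN2' : 2 ≤ N := hN2 z hz₁
  have hN1 : 1 ≤ N := by linarith
  set X : ℝ := d * E * N ^ ((n : ℕ) : ℝ) with hX
  have hEX : E ≤ X := by
    rw [hX, Real.rpow_natCast]
    calc E = 1 * E * 1 := by ring
      _ ≤ d * E * N ^ n := by
          gcongr
          exact one_le_pow₀ hN1
  have hX0 : 0 < X := hE0.trans_le hEX
  set p' : ℝ := (3 / 2 - z.re) / (3 / 2 - -1 / 2) with hp'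
  set q : ℝ := (z.re - -1 / 2) / (3 / 2 - -1 / 2) with hq
  have hp0 : 0 ≤ p' := by rw [hp']; apply div_nonneg <;> linarith
  have hq0 : 0 ≤ q := by rw [hq]; apply div_nonneg <;> linarith
  have hpq : p' + q = 1 := by rw [hp', hq]; field_simp; ring
  have hfin : X ^ p' * E ^ q ≤ X := by
    calc X ^ p' * E ^ q ≤ X ^ p' * X ^ q := by gcongr
      _ = X := by rw [← Real.rpow_add hX0, hpq, Real.rpow_one]
  calc ‖L z‖ ≤ X ^ p' * E ^ q := hR
    _ ≤ X := hfin
    _ = d * E * N ^ n := by rw [hX, Real.rpow_natCast]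

/-- The bound on the discs `|z − (2 + it)| ≤ 2` used by Jensen-type zero counts:
`|L(z)| ≤ |d_K| 𝔑(𝔪) e^{2 n_K} (|t| + 7)^{n_K}`. [cite: Rademacher1959, Theorem 5] -/
theorem exists_continuation_norm_le_of_mem_closedBall (hψ : IsRayClassCharacter 𝔪 ψ) (hprim : IsPrimitive 𝔪 ψ)
    (hp : IsSignType 𝔪 ψ p) (h𝔪 : 𝔪 ≠ ⊥)
    (hnt : ∃ v : HeightOneSpectrum (𝓞 K), ¬ 𝔪 ≤ v.asIdeal ∧ ψ v ≠ 1) :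
    ∃ L : ℂ → ℂ, Differentiable ℂ L ∧ (∀ s : ℂ, 1 < s.re → L s = rayClassLSeries 𝔪 ψ s) ∧
      ∀ (t : ℝ) (z : ℂ), z ∈ closedBall ((2 : ℂ) + t * I) 2 →
        ‖L z‖ ≤ (|(discr K : ℝ)| * (Ideal.absNorm 𝔪 : ℝ)) * Real.exp (2 * Module.finrank ℚ K) *
          (|t| + 7) ^ Module.finrank ℚ K := by
  obtain ⟨L, hLd, hLs, hb⟩ := exists_continuation_norm_le hψ hprim hp h𝔪 hnt
  refine ⟨L, hLd, hLs, fun t z hz ↦ ?_⟩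
  rw [mem_closedBall, dist_eq_norm] at hz
  have hre : -1 / 2 ≤ z.re := by
    have h1 : |(z - (2 + t * I)).re| ≤ 2 := (abs_re_le_norm _).trans hz
    have h2 : (z - (2 + t * I)).re = z.re - 2 := by simp
    rw [h2] at h1
    have := (abs_le.mp h1).1
    linarith
  refine (hb z hre).trans ?_
  have hN : ‖z + 5 / 2‖ ≤ |t| + 7 := by
    calc ‖z + 5 / 2‖ = ‖(z - (2 + t * I)) + (9 / 2 + t * I)‖ := by ring_nf
      _ ≤ ‖z - (2 + t * I)‖ + ‖(9 / 2 : ℂ) + t * I‖ := norm_add_le _ _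
      _ ≤ 2 + (9 / 2 + |t|) := by
          gcongr
          calc ‖(9 / 2 : ℂ) + t * I‖ ≤ ‖(9 / 2 : ℂ)‖ + ‖(t : ℂ) * I‖ := norm_add_le _ _
            _ = 9 / 2 + |t| := by
                rw [norm_mul, Complex.norm_I, mul_one, Complex.norm_real, Real.norm_eq_abs]
                norm_num
      _ ≤ |t| + 7 := by linarith
  have hA0 : 0 ≤ (|(discr K : ℝ)| * (Ideal.absNorm 𝔪 : ℝ)) * Real.exp (2 * Module.finrank ℚ K) := by positivity
  exact mul_le_mul_of_nonneg_left (pow_le_pow_left₀ (norm_nonneg _) hN _) hA0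

end Literature.NumberTheory.LFunctions
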